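import Summits.HodgeConjecture.HodgeCM.PerL34.FockPrintDefinite_1

/-! PORT of `HodgeCM/PerL34/FockPrintDefinite.lean` (HodgeCMPerL run 82) — part 2: continuation of `Summits.HodgeConjecture.HodgeCM.PerL34.FockPrintDefinite_1` (split at a top-level declaration boundary by port_pkg.py; scope re-opened below; declarations unchanged). -/

-- port_pkg: scope re-opened for this part (file-level context, then the namespace/section stack open at the cut)
namespace HodgeCM
namespace PerL34
namespace Fock
open MvPolynomial Complex Finsupp
open scoped BigOperators
namespace PrintDict
attribute [local instance 100] LieRing.ofAssociativeRing
section NegativeDefinite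
/-- **`U(1)`-part, negative line (KERNEL)**: the scalars act by `−(z̄₁∂̄₁ + z̄₂∂̄₂ + z̄₃∂̄₃ + 3/2)`. -/
theorem fockOp_rho_one_negDefWt (lam : ℂ) :
    fockOp (sf negDefWt) (ee negDefWt) (ff negDefWt) lam (rho negDefWt 1) = -(weightOp posWt + (3 / 2 : ℂ) • 1) := by
  rw [← fockOp_rho_one_posWt lam, fockOp_apply, fockOp_apply]
  simp only [Fin.sum_univ_three]
  simp [Matrix.one_apply, ee, ff, Pi.single_apply]
  module

/-- `Sym^d(V̄)` is the `−(d + 3/2)`-eigenspace of the printed `U(1)`-action: `σ = b₁ + (m−n)/2`, `b₁ = −d`. -/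
theorem mem_dpiece_iff_fockOp_negDefWt (lam : ℂ) (d : ℕ) (g : DefModel) :
    g ∈ dpiece d ↔
      fockOp (sf negDefWt) (ee negDefWt) (ff negDefWt) lam (rho negDefWt 1) g = (-((d : ℂ) + 3 / 2)) • g := by
  rw [mem_dpiece_iff_fockOp lam d g, fockOp_rho_one_posWt, fockOp_rho_one_negDefWt, LinearMap.neg_apply, neg_smul,
    neg_inj]

/-- Adams's composite for the negative definite pair at `ψ̄(1) = −i`, as a linear map and as a Lie hom. -/
noncomputable def printedRepNegDefLin : Matrix (Fin 3) (Fin 3) ℂ →ₗ[ℂ] Module.End ℂ DefModel :=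
  (fockOp (sf negDefWt) (ee negDefWt) (ff negDefWt) (-I)) ∘ₗ rhoLin negDefWt

/-- (Ported verbatim from the HodgeCMPerL package; no docstring in the source.) -/
theorem printedRepNegDefLin_apply (A : Matrix (Fin 3) (Fin 3) ℂ) :
    printedRepNegDefLin A = fockOp (sf negDefWt) (ee negDefWt) (ff negDefWt) (-I) (rho negDefWt A) := rfl

/-- (Ported verbatim from the HodgeCMPerL package; no docstring in the source.) -/
theorem printedRepNegDefLin_eq (A : Matrix (Fin 3) (Fin 3) ℂ) :
    printedRepNegDefLin A = dERep (-A.transpose) - ((1 / 2 : ℂ) * A.trace) • (1 : Module.End ℂ DefModel) := by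
  rw [printedRepNegDefLin_apply, fockOp_rho_eq_dERep_negDefWt']

/-- `A ↦ −Aᵀ` is a Lie algebra homomorphism (the contragredient). -/
theorem neg_transpose_lie (A B : Matrix (Fin 3) (Fin 3) ℂ) : -(⁅A, B⁆).transpose = ⁅-A.transpose, -B.transpose⁆ := by
  simp only [Ring.lie_def, Matrix.transpose_sub, Matrix.transpose_mul, neg_mul, mul_neg, neg_neg, neg_sub]

/-- (Ported verbatim from the HodgeCMPerL package; no docstring in the source.) -/
theorem printedRepNegDefLin_lie (A B : Matrix (Fin 3) (Fin 3) ℂ) :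
    printedRepNegDefLin ⁅A, B⁆ = ⁅printedRepNegDefLin A, printedRepNegDefLin B⁆ := by
  rw [printedRepNegDefLin_eq, printedRepNegDefLin_eq, printedRepNegDefLin_eq, trace_lie_eq_zero_fin3, mul_zero,
    zero_smul, sub_zero, neg_transpose_lie, LieHom.map_lie]
  simp only [LieRing.of_associative_ring_bracket, mul_sub, sub_mul, Algebra.smul_mul_assoc, Algebra.mul_smul_comm,
    mul_one, one_mul]
  module

/-- **The PRINTED oscillator representation of `𝔤𝔩₃(ℂ) = 𝔲(3)_ℂ` on the conjugate model `ℂ[z̄₁, z̄₂, z̄₃]`**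
(negative line, `ψ̄(1) = −i`). -/
noncomputable def printedRepNegDef : Matrix (Fin 3) (Fin 3) ℂ →ₗ⁅ℂ⁆ Module.End ℂ DefModel :=
  { printedRepNegDefLin with
    map_lie' := fun {A B} => printedRepNegDefLin_lie A B }

/-- (Ported verbatim from the HodgeCMPerL package; no docstring in the source.) -/
theorem printedRepNegDef_apply (A : Matrix (Fin 3) (Fin 3) ℂ) :
    printedRepNegDef A = fockOp (sf negDefWt) (ee negDefWt) (ff negDefWt) (-I) (rho negDefWt A) := rfl

/-- (Ported verbatim from the HodgeCMPerL package; no docstring in the source.) -/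
theorem printedRepNegDef_eq_dERep (A : Matrix (Fin 3) (Fin 3) ℂ) :
    printedRepNegDef A = dERep (-A.transpose) - ((1 / 2 : ℂ) * A.trace) • (1 : Module.End ℂ DefModel) :=
  printedRepNegDefLin_eq A

/-- (Ported verbatim from the HodgeCMPerL package; no docstring in the source.) -/
theorem printedRepNegDef_single (a b : Fin 3) :
    printedRepNegDef (Matrix.single a b (1 : ℂ)) = -(dE b a + (1 / 2 : ℂ) • (if a = b then 1 else 0)) := by
  rw [printedRepNegDef_apply, fockOp_rho_single_negDefWt]

/-- (Ported verbatim from the HodgeCMPerL package; no docstring in the source.) -/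
theorem printedRepNegDef_one :
    printedRepNegDef (1 : Matrix (Fin 3) (Fin 3) ℂ) = -(weightOp posWt + (3 / 2 : ℂ) • 1) := by
  rw [printedRepNegDef_apply, fockOp_rho_one_negDefWt]

/-- Stability under the conjugate printed representation = stability under `dERep` (transpose is a bijection
of `𝔤𝔩₃`, sign and scalar shift immaterial); irreducibility of `Sym^d(V̄)` transfers. -/
theorem stable_iff_printedRepNegDef (M : Submodule ℂ DefModel) :
    (∀ A : Matrix (Fin 3) (Fin 3) ℂ, ∀ f ∈ M, printedRepNegDef A f ∈ M) ↔
      ∀ A : Matrix (Fin 3) (Fin 3) ℂ, ∀ f ∈ M, dERep A f ∈ M := by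
  constructor
  · intro h A f hf
    have h1 := h (-A.transpose) f hf
    rw [printedRepNegDef_eq_dERep, Matrix.transpose_neg, Matrix.transpose_transpose, neg_neg, LinearMap.sub_apply,
      LinearMap.smul_apply, Module.End.one_apply] at h1
    have h2 := M.add_mem h1 (M.smul_mem ((1 / 2 : ℂ) * (-A.transpose).trace) hf)
    rwa [sub_add_cancel] at h2
  · intro h A f hf
    rw [printedRepNegDef_eq_dERep, LinearMap.sub_apply, LinearMap.smul_apply, Module.End.one_apply]
    exact M.sub_mem (h _ f hf) (M.smul_mem _ hf)

/-- (Ported verbatim from the HodgeCMPerL package; no docstring in the source.) -/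
theorem dpiece_le_of_printedRepNegDef_stable (d : ℕ) (M : Submodule ℂ DefModel)
    (hM : ∀ A : Matrix (Fin 3) (Fin 3) ℂ, ∀ f ∈ M, printedRepNegDef A f ∈ M) {v : DefModel} (hvM : v ∈ M)
    (hv : v ≠ 0) (hvd : v ∈ dpiece d) : dpiece d ≤ M :=
  dpiece_le_of_dERep_stable d M ((stable_iff_printedRepNegDef M).mp hM) hvM hv hvd

/-- Printed Cartan weights on the conjugate model: `E_{aa}` acts on `c · z̄^m` by `−(m_a + ½)`. -/
theorem printedRepNegDef_diag_monomial (a : Fin 3) (m : Fin 3 →₀ ℕ) (c : ℂ) :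
    printedRepNegDef (Matrix.single a a (1 : ℂ)) (monomial m c) = (-((m a : ℕ) + 1 / 2 : ℂ)) • monomial m c := by
  rw [printedRepNegDef_single, if_pos rfl, LinearMap.neg_apply, LinearMap.add_apply, dE_diag_monomial,
    LinearMap.smul_apply, Module.End.one_apply, ← add_smul, ← neg_smul]

/-- The constants have printed `K̃′ = Ũ(3)`-weight `(−½, −½, −½) = (−p/2, −p/2, −p/2)` and `Ũ(1)`-weight
`−3/2 = (m − n)/2` ([Ad07 p0023 L22], `p = 1`, `(m, n) = (0, 3)`). -/
theorem printedRepNegDef_vacuum (a : Fin 3) :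
    printedRepNegDef (Matrix.single a a (1 : ℂ)) (1 : DefModel) = (-(1 / 2) : ℂ) • 1 ∧
      printedRepNegDef (1 : Matrix (Fin 3) (Fin 3) ℂ) (1 : DefModel) = (-(3 / 2) : ℂ) • 1 := by
  have h1 : (1 : DefModel) = monomial 0 1 := rfl
  refine ⟨?_, ?_⟩
  · rw [h1, printedRepNegDef_diag_monomial, Finsupp.coe_zero, Pi.zero_apply, Nat.cast_zero, zero_add]
  · have h0 : (1 : DefModel) ∈ dpiece 0 := by
      rw [mem_dpiece_iff_isHomogeneous]; exact isHomogeneous_one (Fin 3) ℂ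
    rw [printedRepNegDef_apply, (mem_dpiece_iff_fockOp_negDefWt (-I) 0 1).mp h0, Nat.cast_zero, zero_add]

/-- `z̄₃^d` is killed by the raising operators `E₁₂ ↦ −z̄₂∂̄₁`, `E₁₃ ↦ −z̄₃∂̄₁`, `E₂₃ ↦ −z̄₃∂̄₂` (a highest weight
vector of `Sym^d(V̄) ≅ (Sym^d V)^*`). -/
theorem printedRepNegDef_raise_zmon (d : ℕ) :
    printedRepNegDef (Matrix.single 0 1 (1 : ℂ)) (zmon 2 d) = 0 ∧
      printedRepNegDef (Matrix.single 0 2 (1 : ℂ)) (zmon 2 d) = 0 ∧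
      printedRepNegDef (Matrix.single 1 2 (1 : ℂ)) (zmon 2 d) = 0 := by
  refine ⟨?_, ?_, ?_⟩ <;>
    rw [printedRepNegDef_single, if_neg (by decide), smul_zero, add_zero, LinearMap.neg_apply, neg_eq_zero, zmon,
      dE_monomial_of_zero _ _ (by rw [single_apply, if_neg (by decide)])]

/-- **Prop. 6.6, `(m, n) = (0, 3)`, `σ = (b₁) − 3/2`, `b₁ = −d`**: the printed weight of `z̄₃^d` is
`(−½, −½, −d − ½) = (0, 0, −d) + (−½, −½, −½)`, and `Ũ(1)` acts by `−d − 3/2 = b₁ + (m−n)/2`. -/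
theorem printedRepNegDef_diag_zmon (d : ℕ) :
    printedRepNegDef (Matrix.single 0 0 (1 : ℂ)) (zmon 2 d) = (-(1 / 2) : ℂ) • zmon 2 d ∧
      printedRepNegDef (Matrix.single 1 1 (1 : ℂ)) (zmon 2 d) = (-(1 / 2) : ℂ) • zmon 2 d ∧
      printedRepNegDef (Matrix.single 2 2 (1 : ℂ)) (zmon 2 d) = (-((d : ℂ) + 1 / 2)) • zmon 2 d ∧
      printedRepNegDef (1 : Matrix (Fin 3) (Fin 3) ℂ) (zmon 2 d) = (-((d : ℂ) + 3 / 2)) • zmon 2 d := by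
  refine ⟨?_, ?_, ?_, ?_⟩
  · rw [zmon, printedRepNegDef_diag_monomial, single_apply, if_neg (by decide), Nat.cast_zero, zero_add]
  · rw [zmon, printedRepNegDef_diag_monomial, single_apply, if_neg (by decide), Nat.cast_zero, zero_add]
  · rw [zmon, printedRepNegDef_diag_monomial, single_eq_same]
  · rw [printedRepNegDef_apply, (mem_dpiece_iff_fockOp_negDefWt (-I) d (zmon 2 d)).mp (zmon_mem_dpiece 2 d)]

end NegativeDefinite

end PrintDict

end Fock
end PerL34
end HodgeCM
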